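import Summits.FinalStateConjecture.FinalStateConjecture.Theorems.EIHFluxBalanceInertialRecessionBoostCalculus
import Summits.FinalStateConjecture.FinalStateConjecture.Theorems.EIHFluxBalanceInertialRecessionLorentz
import Mathlib.Analysis.Calculus.ContDiff.Bounds
import Mathlib.Analysis.Calculus.IteratedDeriv.Lemmas
import Mathlib.Analysis.SpecialFunctions.Sqrt

/-!
# Route EIHFluxBalance — item `WeightedQuasiStationarity` (stmt-FinalStateConjecture-16928),
# negative lane: pure boosts along a smooth subluminal velocity path

Helper file (2/3) of the kinematic-shadow refutation
`…WeightedQuasiStationarity.Negative.KinematicShadow.not_weightedQuasiStationarity_kinematicShadow`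
(`--supports stmt-FinalStateConjecture-16928`; no Theses decl is asserted).

* §3 `tendsto_iteratedDeriv_comp` — Faà di Bruno without a formula: if `F` is smooth on the unit
  ball of `E3` and the path `w` (`‖w‖ ≤ r < 1`) has its first three derivatives tending to `0`, so
  does `t ↦ F(w(t))` (`norm_iteratedFDeriv_comp_le'` with `D = δ`, eventually);
* §5 the painted frame `Λ(t) = boost(w(t))` (`Lorentz.boost`): smoothness of `t ↦ boostCLM(w(t))`,
  the Lorentz-factor bound `γ ≤ 2` for `‖w‖ ≤ 1/4`, the lower bound `‖(γ(w)w)˙‖ ≤ ‖(Λe₀)˙‖`, the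
  frame rate at a zero of the speed, and the weighted amplitude bound
  `1/8 ≤ (1/4) t^{3/4}(1+t²)^{-1/4}` (`t ≥ 1`). (The translational slaving expression
  `γ⁻¹ • (Λe₀)~ = w` is `boostVelocity_boost` of file `…FlatPackage`, re-derived inline downstream.)
-/

set_option linter.dupNamespace false

noncomputable section

namespace Summit.FinalStateConjecture.FinalStateConjecture.Theorems.WeightedQuasiStationarity.Negative

open scoped Topology
open Filter Set Function Metric Literature.Geometry.Lorentzian
open Summit.FinalStateConjecture.FinalStateConjecture.Theorems

/-! ### §3 Iterated derivatives of a smooth function of a path with vanishing derivatives -/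

/-- **Faà di Bruno without a formula.** Let `F : E3 → E4` be smooth on the open unit ball and
`w : ℝ → E3` a smooth path with `‖w(t)‖ ≤ r < 1` whose first three derivatives tend to `0`. Then the
first three derivatives of `t ↦ F(w(t))` tend to `0`: for `δ ≤ 1` eventually `‖w⁽ⁱ⁾(t)‖ ≤ δ³ ≤ δⁱ`
(`1 ≤ i ≤ 3`), so `‖(F ∘ w)⁽ᵐ⁾(t)‖ ≤ m!·C·δᵐ ≤ 6Cδ` by `norm_iteratedFDeriv_comp_le'`, with `C` a
bound of the derivatives of `F` of order `≤ 3` on the compact ball `‖u‖ ≤ r`. [folklore] -/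
theorem tendsto_iteratedDeriv_comp {F : E3 → E4} {w : ℝ → E3} {r : ℝ} (hr : r < 1)
    (hF : ContDiffOn ℝ (⊤ : ℕ∞) F (ball 0 1)) (hw : ContDiff ℝ (⊤ : ℕ∞) w) (hwr : ∀ t, ‖w t‖ ≤ r)
    (hlim : ∀ i, 1 ≤ i → i ≤ 3 → Tendsto (fun t ↦ iteratedDeriv i w t) atTop (𝓝 0))
    {m : ℕ} (hm1 : 1 ≤ m) (hm3 : m ≤ 3) :
    Tendsto (fun t ↦ iteratedDeriv m (fun s ↦ F (w s)) t) atTop (𝓝 0) := by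
  have hOo : IsOpen (ball (0 : E3) 1) := isOpen_ball
  have hKc : IsCompact (closedBall (0 : E3) r) := isCompact_closedBall _ _
  have hKO : closedBall (0 : E3) r ⊆ ball 0 1 := closedBall_subset_ball hr
  -- uniform bounds for the derivatives of `F` of order `≤ 3` on the compact ball
  have hbound : ∀ i : ℕ, ∃ C : ℝ, ∀ u ∈ closedBall (0 : E3) r,
      ‖iteratedFDerivWithin ℝ i F (ball 0 1) u‖ ≤ C := by
    intro i
    have h1 := hF.continuousOn_iteratedFDerivWithin (m := i) (by exact_mod_cast le_top)
      hOo.uniqueDiffOn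
    obtain ⟨C, hC⟩ := hKc.exists_bound_of_continuousOn (h1.mono hKO)
    exact ⟨C, hC⟩
  choose C hC using hbound
  set Cmax : ℝ := ∑ i ∈ Finset.range 4, |C i| with hCmax
  have hCmax0 : 0 ≤ Cmax := Finset.sum_nonneg fun _ _ ↦ abs_nonneg _
  have hCi : ∀ i ≤ 3, ∀ u ∈ closedBall (0 : E3) r, ‖iteratedFDerivWithin ℝ i F (ball 0 1) u‖ ≤ Cmax :=
    fun i hi u hu ↦ ((hC i u hu).trans (le_abs_self _)).trans
      (Finset.single_le_sum (f := fun i ↦ |C i|) (fun _ _ ↦ abs_nonneg _)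
        (Finset.mem_range.mpr (by omega)))
  have hwt : ∀ t, w t ∈ closedBall (0 : E3) r := fun t ↦ by simpa using hwr t
  have hrange : Set.range w ⊆ ball 0 1 := by
    rintro _ ⟨t, rfl⟩
    exact hKO (hwt t)
  rw [Metric.tendsto_nhds]
  intro ε hε
  -- the smallness parameter `δ`
  obtain ⟨δ, hδ0, hδ1, hδε⟩ : ∃ δ : ℝ, 0 < δ ∧ δ ≤ 1 ∧ 6 * Cmax * δ < ε := by
    refine ⟨min 1 (ε / (6 * Cmax + 1)), by positivity, min_le_left _ _, ?_⟩
    have h1 : min 1 (ε / (6 * Cmax + 1)) ≤ ε / (6 * Cmax + 1) := min_le_right _ _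
    have h2 : 6 * Cmax * (ε / (6 * Cmax + 1)) < ε := by
      rw [mul_div_assoc']
      rw [div_lt_iff₀ (by positivity)]
      nlinarith
    exact lt_of_le_of_lt (mul_le_mul_of_nonneg_left h1 (by positivity)) h2
  have hδ3 : 0 < δ ^ 3 := pow_pos hδ0 3
  -- eventually all three derivatives of `w` are `≤ δ³`
  have hev : ∀ i, 1 ≤ i → i ≤ 3 → ∀ᶠ t in atTop, ‖iteratedDeriv i w t‖ ≤ δ ^ 3 := by
    intro i hi1 hi3
    have h := (hlim i hi1 hi3).norm
    rw [norm_zero] at h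
    exact (h.eventually (ge_mem_nhds hδ3)).mono fun t ht ↦ ht
  filter_upwards [hev 1 le_rfl (by norm_num), hev 2 (by norm_num) (by norm_num),
    hev 3 (by norm_num) le_rfl] with t h1 h2 h3
  have hD : ∀ i, 1 ≤ i → i ≤ m → ‖iteratedFDeriv ℝ i w t‖ ≤ δ ^ i := by
    intro i hi1 him
    rw [norm_iteratedFDeriv_eq_norm_iteratedDeriv]
    have hi3 : i ≤ 3 := him.trans hm3
    have hle : ‖iteratedDeriv i w t‖ ≤ δ ^ 3 := by
      interval_cases i
      · exact h1
      · exact h2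
      · exact h3
    exact hle.trans (pow_le_pow_of_le_one hδ0.le hδ1 hi3)
  have hCt : ∀ i ≤ m, ‖iteratedFDerivWithin ℝ i F (ball 0 1) (w t)‖ ≤ Cmax :=
    fun i hi ↦ hCi i (hi.trans hm3) (w t) (hwt t)
  have hcomp := norm_iteratedFDeriv_comp_le' (𝕜 := ℝ) (g := F) (f := w) (n := m)
    (N := ((⊤ : ℕ∞) : WithTop ℕ∞)) hrange hOo.uniqueDiffOn hF hw (by exact_mod_cast le_top) t hCt hD
  rw [dist_zero_right, ← norm_iteratedFDeriv_eq_norm_iteratedDeriv]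
  change ‖iteratedFDeriv ℝ m (F ∘ w) t‖ < ε
  refine lt_of_le_of_lt hcomp ?_
  have hfact : (m.factorial : ℝ) ≤ 6 := by
    interval_cases m
    · simp [Nat.factorial]
    · norm_num [Nat.factorial]
    · norm_num [Nat.factorial]
  have hδm : δ ^ m ≤ δ := by
    calc δ ^ m ≤ δ ^ 1 := pow_le_pow_of_le_one hδ0.le hδ1 hm1
      _ = δ := pow_one δ
  calc (m.factorial : ℝ) * Cmax * δ ^ m ≤ 6 * Cmax * δ := by
        apply mul_le_mul (mul_le_mul_of_nonneg_right hfact hCmax0) hδm (by positivity)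
          (by positivity)
    _ < ε := hδε

/-! ### §5 Pure boosts along a smooth subluminal velocity path -/

/-- A velocity of norm `≤ 1/4` is subluminal. [folklore] -/
theorem norm_lt_one_of_le_quarter {v : E3} (h : ‖v‖ ≤ 1 / 4) : ‖v‖ < 1 := by linarith

/-- The Lorentz factor of a velocity of norm `≤ 1/4` is at most `2`. [folklore] -/
theorem gamma_le_two {v : E3} (h : ‖v‖ ≤ 1 / 4) : Lorentz.gamma v ≤ 2 := by
  have hv := norm_lt_one_of_le_quarter h
  have h1 : (1 / 2 : ℝ) ≤ Real.sqrt (1 - ‖v‖ ^ 2) := by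
    rw [show (1 / 2 : ℝ) = Real.sqrt ((1 / 2) ^ 2) by rw [Real.sqrt_sq (by norm_num)]]
    exact Real.sqrt_le_sqrt (by nlinarith [norm_nonneg v])
  unfold Lorentz.gamma
  rw [inv_le_comm₀ (Real.sqrt_pos.mpr (Lorentz.one_sub_norm_sq_pos hv)) (by norm_num)]
  simpa using h1

/-- **Smooth frames from a smooth subluminal velocity path**: `t ↦ boostCLM(w(t))` is `C^∞`.
[folklore] -/
theorem contDiff_boostCLM_comp {w : ℝ → E3} (hw : ContDiff ℝ (⊤ : ℕ∞) w)
    (hw1 : ∀ t, ‖w t‖ < 1) : ContDiff ℝ (⊤ : ℕ∞) fun t ↦ Lorentz.boostCLM (w t) := by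
  have hmaps : ∀ t, w t ∈ ball (0 : E3) 1 := fun t ↦ by simpa using hw1 t
  rw [contDiff_iff_contDiffAt]
  intro t
  have h2 : ContDiffAt ℝ (⊤ : ℕ∞) Lorentz.boostCLM (w t) :=
    (contDiffOn_boostCLM (w t) (hmaps t)).contDiffAt (isOpen_ball.mem_nhds (hmaps t))
  exact h2.comp t hw.contDiffAt

/-- `v ↦ boostCLM(v) v₀` is smooth on the open unit ball. [folklore] -/
theorem contDiffOn_boostCLM_apply (v₀ : E4) :
    ContDiffOn ℝ (⊤ : ℕ∞) (fun v ↦ Lorentz.boostCLM v v₀) (ball (0 : E3) 1) :=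
  contDiffOn_boostCLM.clm_apply contDiffOn_const

/-- **The spatial 4-velocity controls the frame rate from below**: for a smooth subluminal velocity
path `w`, `‖(γ(w)w)˙(t)‖ ≤ ‖(Λe₀)˙(t)‖` with `Λ(t) = boost(w(t))` (the spatial part of `Λe₀` is
`γ(w)w`, and `‖x⃗‖ ≤ ‖x‖`). [folklore] -/
theorem norm_deriv_gamma_smul_le {w : ℝ → E3} (hw : ContDiff ℝ (⊤ : ℕ∞) w) (hw1 : ∀ t, ‖w t‖ < 1)
    (t : ℝ) :
    ‖deriv (fun s ↦ Lorentz.gamma (w s) • w s) t‖ ≤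
      ‖deriv (fun s ↦ ((Lorentz.boost (w s) (hw1 s) : E4 ≃L[ℝ] E4) (E4.basisVector 0))) t‖ := by
  set B : ℝ → E4 →L[ℝ] E4 := fun s ↦ Lorentz.boostCLM (w s) with hB
  have hBd : HasDerivAt B (deriv B t) t :=
    (((contDiff_boostCLM_comp hw hw1).differentiable (by simp)) t).hasDerivAt
  have hG : HasDerivAt (fun s ↦ ((Lorentz.boost (w s) (hw1 s) : E4 ≃L[ℝ] E4) (E4.basisVector 0)))
      ((deriv B t) (E4.basisVector 0)) t := by
    have h := (ContinuousLinearMap.apply ℝ E4 (E4.basisVector 0)).hasFDerivAt.comp_hasDerivAt t hBd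
    exact h
  have hV : HasDerivAt (fun s ↦ Lorentz.gamma (w s) • w s)
      (E4.spatial ((deriv B t) (E4.basisVector 0))) t := by
    have h := E4.spatial.hasFDerivAt.comp_hasDerivAt t hG
    refine h.congr_of_eventuallyEq (Eventually.of_forall fun s ↦ ?_)
    change Lorentz.gamma (w s) • w s =
      E4.spatial ((Lorentz.boost (w s) (hw1 s) : E4 ≃L[ℝ] E4) (E4.basisVector 0))
    rw [Lorentz.spatial_boost_apply_basisVector_zero, Lorentz.boost_apply_basisVector_zero_zero]
  rw [hV.deriv, hG.deriv]
  -- `‖x⃗‖ ≤ ‖x‖` on `E4`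
  set x : E4 := (deriv B t) (E4.basisVector 0)
  have h := norm_sq_eq_sq_add_spatialNorm_sq x
  have h0 := E4.spatialNorm_nonneg x
  change E4.spatialNorm x ≤ ‖x‖
  nlinarith [sq_nonneg (x 0), norm_nonneg x]

/-- **The frame rate at a zero of the speed.** For `w = u • e` with `‖e‖ = 1`, at a time `t₀` with
`u(t₀) = 0` and `u̇(t₀) = u'`: `(γ(w)w)˙(t₀) = u' • e` (the Lorentz factor is stationary there).
[folklore] -/
theorem hasDerivAt_gamma_smul_of_zero {u : ℝ → ℝ} {u' t₀ : ℝ} {e : E3} (he : ‖e‖ = 1)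
    (hu : HasDerivAt u u' t₀) (h0 : u t₀ = 0) :
    HasDerivAt (fun s ↦ Lorentz.gamma (u s • e) • (u s • e)) (u' • e) t₀ := by
  have hnorm : ∀ s, ‖u s • e‖ = |u s| := fun s ↦ by rw [norm_smul, he, mul_one, Real.norm_eq_abs]
  have hfun : (fun s ↦ Lorentz.gamma (u s • e) • (u s • e)) =
      fun s ↦ ((Real.sqrt (1 - u s ^ 2))⁻¹ * u s) • e := by
    funext s
    rw [smul_smul]
    unfold Lorentz.gamma
    rw [hnorm, sq_abs]
  rw [hfun]
  -- the Lorentz factor is differentiable with derivative `0` at `t₀`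
  have h1 : HasDerivAt (fun s ↦ 1 - u s ^ 2) 0 t₀ := by
    have h := (hu.pow 2).const_sub 1
    simp only [h0] at h
    simpa using h
  have hne : 1 - u t₀ ^ 2 ≠ 0 := by rw [h0]; norm_num
  have h2 : HasDerivAt (fun s ↦ Real.sqrt (1 - u s ^ 2)) 0 t₀ := by
    simpa using h1.sqrt hne
  have hsq : Real.sqrt (1 - u t₀ ^ 2) = 1 := by rw [h0]; simp
  have h3 : HasDerivAt (fun s ↦ (Real.sqrt (1 - u s ^ 2))⁻¹) 0 t₀ := by
    have h := h2.inv (by rw [hsq]; exact one_ne_zero)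
    simp only [neg_zero, zero_div] at h
    exact h
  have h4 : HasDerivAt (fun s ↦ (Real.sqrt (1 - u s ^ 2))⁻¹ * u s) u' t₀ := by
    have h := h3.mul hu
    simp only [zero_mul, zero_add, hsq, inv_one, one_mul] at h
    exact h
  exact h4.smul_const e

/-- The weighted amplitude is bounded below: `1/8 ≤ (1/4) t^{3/4} (1+t²)^{-1/4}` for `t ≥ 1`
(`(t^{3/4}(1+t²)^{-1/4})⁴ = t³/(1+t²) ≥ t/2 ≥ 1/2 ≥ (1/2)⁴`). [folklore] -/
theorem weighted_ampl_ge {t : ℝ} (ht : 1 ≤ t) :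
    1 / 8 ≤ t ^ (3 / 4 : ℝ) * ((1 / 4 : ℝ) * (1 + t ^ 2) ^ (-(1 / 4 : ℝ))) := by
  have ht0 : 0 < t := one_pos.trans_le ht
  have hf : 0 < 1 + t ^ 2 := by positivity
  set x : ℝ := t ^ (3 / 4 : ℝ) * (1 + t ^ 2) ^ (-(1 / 4 : ℝ)) with hx
  have hx0 : 0 ≤ x := mul_nonneg (Real.rpow_nonneg ht0.le _) (Real.rpow_nonneg hf.le _)
  have hx4 : x ^ 4 = t ^ 3 * (1 + t ^ 2)⁻¹ := by
    rw [hx, mul_pow, ← Real.rpow_natCast (t ^ (3 / 4 : ℝ)) 4, ← Real.rpow_mul ht0.le,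
      ← Real.rpow_natCast ((1 + t ^ 2) ^ (-(1 / 4 : ℝ))) 4, ← Real.rpow_mul hf.le]
    norm_num
    exact Or.inl (Real.rpow_neg_one _)
  have hx4ge : (1 / 2 : ℝ) ^ 4 ≤ x ^ 4 := by
    rw [hx4]
    rw [show t ^ 3 * (1 + t ^ 2)⁻¹ = t ^ 3 / (1 + t ^ 2) from rfl, le_div_iff₀ hf]
    nlinarith [pow_le_pow_left₀ zero_le_one ht 2, pow_le_pow_left₀ zero_le_one ht 3]
  have hxge : 1 / 2 ≤ x := le_of_pow_le_pow_left₀ (by norm_num) hx0 hx4ge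
  rw [show t ^ (3 / 4 : ℝ) * ((1 / 4 : ℝ) * (1 + t ^ 2) ^ (-(1 / 4 : ℝ))) = (1 / 4) * x by
    rw [hx]; ring]
  linarith

end Summit.FinalStateConjecture.FinalStateConjecture.Theorems.WeightedQuasiStationarity.Negative

end
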